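import Literature.MathematicalPhysics.QuantumFieldTheory.Balaban1983to89.B15Ineq146From190
import Literature.MathematicalPhysics.QuantumFieldTheory.Balaban1983to89.B15Ineq148Proof
import Literature.MathematicalPhysics.QuantumFieldTheory.Balaban1983to89.B15GammaClauses

/-!
# `Balaban1983to89.B15Ineq148From190` — [Balaban1989LargeFieldI] (1.48) p. 186 ON THE LATTICE MODEL END-TO-END FROM
# [15] (190): r12's `B15Ineq146From190.ineq146_of_ineq190` ((1.46)₂ from (190) through p29's plaquette mechanism) composed
# with b01/p29's `B15Ineq148Proof.ineq148_of_146_147` ((1.46) ∧ (1.47) ⇒ (1.48)), the two αβ-majorisations from γ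
# (`B15GammaClauses.alpha1_clause148_of_gamma`, `B15GammaSmallness.logPow_ratio_le` style), the geometric input (1.47) kept
# as the printed hypothesis on the scaled distance

statement-level skeleton of published theorems with citation tags; proofs where landed; nothing here is a claim about
the Yang–Mills mass gap.

CITATION HEADER (lean-in-tree rule 2026-08-18).  T. Bałaban, *Large field renormalization. I. The basic step of the 𝐑
operation*, Commun. Math. Phys. **122**, 175–202 (1989), doi:10.1007/BF01257412, bib `Balaban1989LargeFieldI` (cell paper
B15; PDF held `paper:balaban1989-cmp122-large-field-i`; p. 186 = PDF 12, OCR `p0012.txt` + x2 render).  "[15]" =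
[Balaban1985Variational] (190) p. 308; "[3]" = [Balaban1984PropagatorsII] (2.61); "[14]" = [Balaban1985LGTPropagators]
(1.43)–(1.46); "[III]" = [Balaban1988Convergent] (2.4)/(2.8).  WHAT IS REPRODUCED: SKELETON row `B15.Eq1.48` (with
`B15.Eq1.46`, `B15.Eq1.47`), unit `lit-balaban-r12` gen 8, HOME `run/shared/lean/pub/lit-balaban/` (`lit-balaban-r12/ROWS-B15.md`).
KNITTING — used BY NAME, nothing restated: `B15Ineq146From190.ineq146_of_ineq190` (r12 g8 ∘ p29 g6),
`B15Ineq148Proof.ineq148_of_146_147` (b01/p29), `B15.PrelimIntegrations.ineq147_of_dist` (r12 g1),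
`B15GammaClauses.alpha1_clause148_of_gamma` (r12 g8).

THE PRINTED TEXT (p. 186, verbatim): *"Thus, by the definition of the domains Z″_i, we obtain exp(−δd(y,Ω^c_{j+1}∖Z″_{j+1}))
≦ exp(−δ(M/M₁)(j − i)) for y ∈ Γ″_i, i < j. (1.47) We choose M large enough, so that δ(M/M₁) ≧ 2. … Let us choose a bound
for these two factors in the form αβ, where an absolute constant α will be chosen later. Then the estimate (1.46) and the
above bounds imply |U^{(n)}_{k,Z}(∂p) − 1| ≦ |U^{(n+1)}_{k,Z}(∂p) − 1|(1 + αβ2^{−(j−i)}) + αβ2^{−(j−i)}ε_i(L^{k−i}η)² for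
p ∈ B^i(y), (1.48)"*.

WHAT THIS FILE PROVES (kernel-checked, zero `sorry`; no `def`, no new `Prop`, no new named fact; axioms standard).
* `ineq148_lattice_of_ineq190_gamma` — `Ineq148 dev dev′ α β 2^{−(j−i)} (ε_i(L^{k−i}η)²)` for p29's lattice plaquette
  deviations `dev = |U^{(n)}_{k,Z}(∂p) − 1|`, `dev′ = |U^{(n+1)}_{k,Z}(∂p) − 1|` ((1.44) with `e^{iηℍ}`), from: the
  hypotheses of `ineq146_of_ineq190` ((190) for the two block sizes, (2.61), the argument field `≤ 4δ′_j` localised at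
  scaled distance `≥ dist`, mean-value domination, the dictionary `hdom…`, the located smallness `128B₃δ′_j ≤ 1`, the flow
  factor (2.8)), the GEOMETRIC INPUT of (1.47) as printed (`(M/M₁)(j − i) ≤ dist`, hypothesis `hgeo`), `δ(M/M₁) ≥ 2` in the
  form `τ(M/M₁) ≥ 2` (the decay rate is the (190)/(2.61) rate `τ`), and the two αβ-majorisations FROM γ: `hα₁` by
  `alpha1_clause148_of_gamma` (ratio `(A₁/A₀)(log g_j⁻²)^{p₁−p₀}`, `p₁ < p₀`, `0 < g_j ≤ γ`, `log γ⁻² ≥ 1`, clause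
  `9B₃(A₁/A₀)(log γ⁻²)⁻¹(1+β₀) ≤ αβ`), `hα₂` from `δ′_j ≤ A₁(4p₁)^{p₁}√γ` (hypothesis `hδ'γ`; along flows it is
  `B15GammaSmallness.deltaPrimeK_le_sqrt`), `L^{−i} ≤ 1` and the clause `8B₃A₁(4p₁)^{p₁}√γ ≤ αβ`; here `B₃ = Cκ_Bc`.
* §2 (v1.1) `ineq148_lattice_of_ineq190_gamma'` — the located smallness `128B₃δ′_j ≤ 1` replaced by the γ-clause `128B₃A₁(4p₁)^{p₁}√γ ≤ 1`.
HONEST SCOPE.  (190), the dictionary, the (1.47) distance input and p29's located inputs are hypotheses.  NOT summit progress.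
-/

namespace Literature.MathematicalPhysics.QuantumFieldTheory.Balaban1983to89.B15Ineq148From190

open Literature.MathematicalPhysics.QuantumFieldTheory.Balaban1983to89
open B11SectG B7Prop1Explicit B15.PrelimIntegrations B15.BasicStep B15.Ineq194Flow B15HDecayLeaves B15Ineq146Proof
  B15Ineq146From190 B15Ineq148Proof B15GammaSmallness B15GammaClauses

/-- **(1.48) ON THE LATTICE MODEL, FROM [15] (190), (1.47)'s distance input, AND γ**
(`ineq148_of_146_147 ∘ ineq146_of_ineq190`, αβ-clauses from γ). [cite: Balaban1989LargeFieldI, (1.46)–(1.48) p.186; Balaban1985Variational, (190) p.308] -/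
theorem ineq148_lattice_of_ineq190_gamma
    -- [15]'s block-majorant data for (1.45)
    {gB : B6.Geometry} {FB FA : Type} [AddCommGroup FB] [Module ℝ FB] [AddCommGroup FA] [Module ℝ FA]
    {T : Type*} {bB : BlockNorm gB FB} {bout₀ bout₁ : BlockNorm gB FA} {dH : T → FB →ₗ[ℝ] FA}
    {C δ₀ σ τ c δ'j dist : ℝ}
    (h190₀ : ∀ t, Ineq190 bB bout₀ (dH t) C δ₀) (h190₁ : ∀ t, Ineq190 bB bout₁ (dH t) C δ₀) (hC : 0 ≤ C)
    (hd : ∀ a b : gB.Site, 0 ≤ gB.dist a b) (hrow : RowSum gB σ c) (hτ : 0 ≤ τ) (hστ : σ + τ ≤ δ₀ / 8)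
    (B : FB) (hm : ∀ y', bB.loc y' B ≤ 4 * δ'j) (y : gB.Site) (hD : ∀ y', bB.loc y' B ≠ 0 → dist ≤ gB.dist y y')
    {HB : FA} (hmv₀ : ∀ s : ℝ, (∀ t, bout₀.loc y (dH t B) ≤ s) → bout₀.loc y HB ≤ s)
    (hmv₁ : ∀ s : ℝ, (∀ t, bout₁.loc y (dH t B) ≤ s) → bout₁.loc y HB ≤ s)
    -- the lattice data of (1.44)/(1.46)
    {d : ℕ} {𝔸 : Type*} [CStarAlgebra 𝔸] [Nontrivial 𝔸]
    {η : ℝ} (hη : 0 < η) {U₀ : B7Prop1Explicit.Site d → Fin d → 𝔸ˣ} (h₀ : ∀ z κ, U₀ z κ ∈ U1 𝔸)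
    {H : B7Prop1Explicit.Site d → Fin d → 𝔸} (hH : ∀ z κ, IsSelfAdjoint (H z κ))
    {g : B7Prop1Explicit.Site d → 𝔸ˣ} (hg : ∀ z, g z ∈ U1 𝔸) (μ ν : Fin d) (x : B7Prop1Explicit.Site d)
    {β₀ εi εj Linv Lpow γ gj A₀ A₁ M M₁ α β : ℝ} {i j p₀ p₁ : ℕ}
    -- the dictionary
    (hdom₁ : Lpow * η * ‖H x μ‖ ≤ bout₀.loc y HB) (hdom₂ : Lpow * η * ‖H (x + e μ) ν‖ ≤ bout₀.loc y HB)
    (hdom₃ : Lpow * η * ‖H (x + e ν) μ‖ ≤ bout₀.loc y HB) (hdom₄ : Lpow * η * ‖H x ν‖ ≤ bout₀.loc y HB)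
    (hdomD₁ : (Lpow * η) ^ 2 * ‖B8Ineq132.covDerivFwd η U₀ μ (fun z => H z ν) x‖ ≤ bout₁.loc y HB)
    (hdomD₂ : (Lpow * η) ^ 2 * ‖B8Ineq132.covDerivFwd η U₀ ν (fun z => H z μ) x‖ ≤ bout₁.loc y HB)
    -- p29's located inputs
    (hL : Lpow * Linv = 1) (hLinv : 0 ≤ Linv) (hLinv1 : Linv ≤ 1) (hc : 0 ≤ c) (hδ'j : 0 ≤ δ'j)
    (hdist : 0 ≤ τ * dist) (hsmall : 128 * (C * bB.κ * c) * δ'j ≤ 1)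
    (hflow : εj ≤ (1 + β₀) * (1 + ((j - i : ℕ) : ℝ) ^ (1 / 2 : ℝ)) * εi) (hεi : 0 ≤ εi)
    -- the p. 183 letters: δ′_j/ε_j = (A₁/A₀)(log g_j⁻²)^{p₁−p₀}
    (hA₀ : 0 < A₀) (hA₁ : 0 ≤ A₁) (hβ₀ : 0 ≤ 1 + β₀)
    (hδ' : δ'j = gj * A₁ * logPow p₁ gj) (hεj : εj = gj * A₀ * logPow p₀ gj)
    -- (1.47): the printed distance input and `δ(M/M₁) ≥ 2`
    (hgeo : i < j → M / M₁ * ((j - i : ℕ) : ℝ) ≤ dist) (hM : 2 ≤ τ * (M / M₁))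
    -- the αβ-majorisations from γ
    (hp : p₁ < p₀) (hgj : 0 < gj) (hgjγ : gj ≤ γ) (hγe : 1 ≤ Real.log (γ ^ 2)⁻¹)
    (hγ₁ : 9 * (C * bB.κ * c) * (A₁ / A₀) * (Real.log (γ ^ 2)⁻¹)⁻¹ * (1 + β₀) ≤ α * β)
    (hδ'γ : δ'j ≤ A₁ * (4 * (p₁ : ℝ)) ^ p₁ * Real.sqrt γ)
    (hγ₂ : 8 * (C * bB.κ * c) * (A₁ * (4 * (p₁ : ℝ)) ^ p₁ * Real.sqrt γ) ≤ α * β) :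
    Ineq148 ‖B8Ineq132.plaqF (gaugeAct g (B8Lemma1NonAbelian.mulCfg (B8Eq146AExpansion.expCfg
        (B8Eq146AExpansion.iEta η H)) U₀)) μ ν x - 1‖ ‖B8Ineq132.plaqF U₀ μ ν x - 1‖
      α β ((1 / 2 : ℝ) ^ (j - i)) (εi * Linv ^ 2) := by
  set B₃ := C * bB.κ * c with hB₃def
  have hB₃ : 0 ≤ B₃ := mul_nonneg (mul_nonneg hC bB.κ_nonneg) hc
  -- the letters: log g_j⁻² ≥ log γ⁻² ≥ 1 > 0, the ratio δ′_j/ε_j and its sign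
  have hlog : 0 < Real.log (gj ^ 2)⁻¹ := lt_of_lt_of_le (by linarith) (hγe.trans (B14FlowStep.log_inv_sq_mono hgj hgjγ))
  have hlp₀ : 0 < logPow p₀ gj := by unfold logPow; exact pow_pos hlog _
  have hlp₁ : 0 ≤ logPow p₁ gj := by unfold logPow; exact pow_nonneg hlog.le _
  set ratio := A₁ / A₀ * (logPow p₁ gj / logPow p₀ gj) with hratio_def
  have hratio : 0 ≤ ratio := by positivity
  have hδ'ε : δ'j ≤ ratio * εj := by
    have e : ratio * εj = δ'j := by
      rw [hratio_def, hδ', hεj]; field_simp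
    rw [e]
  -- (1.46)₂ from (190) on the lattice
  have h146 := ineq146_of_ineq190 h190₀ h190₁ hC hd hrow hτ hστ B hm y hD hmv₀ hmv₁ hη h₀ hH hg μ ν x hdom₁ hdom₂
    hdom₃ hdom₄ hdomD₁ hdomD₂ hL hLinv hc hδ'j hdist hsmall hratio hδ'ε hflow
  -- (1.47) from the printed distance input
  have h147 : 0 < j - i → Ineq147 τ dist M M₁ ((j - i : ℕ) : ℝ) := by
    intro hg0
    have hij : i < j := Nat.lt_of_sub_pos hg0
    exact ineq147_of_dist (by nlinarith [hgeo hij, hτ])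
  -- the two αβ-majorisations from γ
  have hα₁ : 9 * B₃ * ratio * (1 + β₀) ≤ α * β :=
    alpha1_clause148_of_gamma hp hgj hgjγ hγe (by positivity) hγ₁
  have hα₂ : 8 * B₃ * Linv * δ'j ≤ α * β := by
    have hA₁γ : 0 ≤ A₁ * (4 * (p₁ : ℝ)) ^ p₁ * Real.sqrt γ := by positivity
    calc 8 * B₃ * Linv * δ'j ≤ 8 * B₃ * Linv * (A₁ * (4 * (p₁ : ℝ)) ^ p₁ * Real.sqrt γ) :=
          mul_le_mul_of_nonneg_left hδ'γ (by positivity)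
      _ ≤ 8 * B₃ * 1 * (A₁ * (4 * (p₁ : ℝ)) ^ p₁ * Real.sqrt γ) := by
          apply mul_le_mul_of_nonneg_right _ hA₁γ
          exact mul_le_mul_of_nonneg_left hLinv1 (by positivity)
      _ = 8 * B₃ * (A₁ * (4 * (p₁ : ℝ)) ^ p₁ * Real.sqrt γ) := by ring
      _ ≤ α * β := hγ₂
  exact ineq148_of_146_147 h146 h147 hdist hM hα₁ hα₂ (by positivity) (norm_nonneg _) (by positivity)

/-! ## §2 (v1.1). The located smallness `128B₃δ′_j ≤ 1` from γ -/

/-- **(1.48) ON THE LATTICE FROM (190), (1.47)'s distance input AND γ — the located smallness from γ too**: as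
`ineq148_lattice_of_ineq190_gamma`, with p29's located `128B₃δ′_j ≤ 1` (`hsmall`, `B₃ = Cκ_Bc`) replaced by the explicit
γ-clause `128B₃·A₁(4p₁)^{p₁}√γ ≤ 1` (using `δ′_j ≤ A₁(4p₁)^{p₁}√γ`, hypothesis `hδ'γ`, = `B15GammaSmallness.deltaPrimeK_le_sqrt`
along flows; cf. `B15GammaSmallness.smallness146_of_gamma`). [cite: Balaban1989LargeFieldI, (1.46)–(1.48) p.186] -/
theorem ineq148_lattice_of_ineq190_gamma'
    -- [15]'s block-majorant data for (1.45)
    {gB : B6.Geometry} {FB FA : Type} [AddCommGroup FB] [Module ℝ FB] [AddCommGroup FA] [Module ℝ FA]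
    {T : Type*} {bB : BlockNorm gB FB} {bout₀ bout₁ : BlockNorm gB FA} {dH : T → FB →ₗ[ℝ] FA}
    {C δ₀ σ τ c δ'j dist : ℝ}
    (h190₀ : ∀ t, Ineq190 bB bout₀ (dH t) C δ₀) (h190₁ : ∀ t, Ineq190 bB bout₁ (dH t) C δ₀) (hC : 0 ≤ C)
    (hd : ∀ a b : gB.Site, 0 ≤ gB.dist a b) (hrow : RowSum gB σ c) (hτ : 0 ≤ τ) (hστ : σ + τ ≤ δ₀ / 8)
    (B : FB) (hm : ∀ y', bB.loc y' B ≤ 4 * δ'j) (y : gB.Site) (hD : ∀ y', bB.loc y' B ≠ 0 → dist ≤ gB.dist y y')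
    {HB : FA} (hmv₀ : ∀ s : ℝ, (∀ t, bout₀.loc y (dH t B) ≤ s) → bout₀.loc y HB ≤ s)
    (hmv₁ : ∀ s : ℝ, (∀ t, bout₁.loc y (dH t B) ≤ s) → bout₁.loc y HB ≤ s)
    -- the lattice data of (1.44)/(1.46)
    {d : ℕ} {𝔸 : Type*} [CStarAlgebra 𝔸] [Nontrivial 𝔸]
    {η : ℝ} (hη : 0 < η) {U₀ : B7Prop1Explicit.Site d → Fin d → 𝔸ˣ} (h₀ : ∀ z κ, U₀ z κ ∈ U1 𝔸)
    {H : B7Prop1Explicit.Site d → Fin d → 𝔸} (hH : ∀ z κ, IsSelfAdjoint (H z κ))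
    {g : B7Prop1Explicit.Site d → 𝔸ˣ} (hg : ∀ z, g z ∈ U1 𝔸) (μ ν : Fin d) (x : B7Prop1Explicit.Site d)
    {β₀ εi εj Linv Lpow γ gj A₀ A₁ M M₁ α β : ℝ} {i j p₀ p₁ : ℕ}
    -- the dictionary
    (hdom₁ : Lpow * η * ‖H x μ‖ ≤ bout₀.loc y HB) (hdom₂ : Lpow * η * ‖H (x + e μ) ν‖ ≤ bout₀.loc y HB)
    (hdom₃ : Lpow * η * ‖H (x + e ν) μ‖ ≤ bout₀.loc y HB) (hdom₄ : Lpow * η * ‖H x ν‖ ≤ bout₀.loc y HB)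
    (hdomD₁ : (Lpow * η) ^ 2 * ‖B8Ineq132.covDerivFwd η U₀ μ (fun z => H z ν) x‖ ≤ bout₁.loc y HB)
    (hdomD₂ : (Lpow * η) ^ 2 * ‖B8Ineq132.covDerivFwd η U₀ ν (fun z => H z μ) x‖ ≤ bout₁.loc y HB)
    -- p29's located inputs
    (hL : Lpow * Linv = 1) (hLinv : 0 ≤ Linv) (hLinv1 : Linv ≤ 1) (hc : 0 ≤ c) (hδ'j : 0 ≤ δ'j)
    (hdist : 0 ≤ τ * dist) (hsmallγ : 128 * (C * bB.κ * c) * (A₁ * (4 * (p₁ : ℝ)) ^ p₁ * Real.sqrt γ) ≤ 1)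
    (hflow : εj ≤ (1 + β₀) * (1 + ((j - i : ℕ) : ℝ) ^ (1 / 2 : ℝ)) * εi) (hεi : 0 ≤ εi)
    -- the p. 183 letters: δ′_j/ε_j = (A₁/A₀)(log g_j⁻²)^{p₁−p₀}
    (hA₀ : 0 < A₀) (hA₁ : 0 ≤ A₁) (hβ₀ : 0 ≤ 1 + β₀)
    (hδ' : δ'j = gj * A₁ * logPow p₁ gj) (hεj : εj = gj * A₀ * logPow p₀ gj)
    -- (1.47): the printed distance input and `δ(M/M₁) ≥ 2`
    (hgeo : i < j → M / M₁ * ((j - i : ℕ) : ℝ) ≤ dist) (hM : 2 ≤ τ * (M / M₁))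
    -- the αβ-majorisations from γ
    (hp : p₁ < p₀) (hgj : 0 < gj) (hgjγ : gj ≤ γ) (hγe : 1 ≤ Real.log (γ ^ 2)⁻¹)
    (hγ₁ : 9 * (C * bB.κ * c) * (A₁ / A₀) * (Real.log (γ ^ 2)⁻¹)⁻¹ * (1 + β₀) ≤ α * β)
    (hδ'γ : δ'j ≤ A₁ * (4 * (p₁ : ℝ)) ^ p₁ * Real.sqrt γ)
    (hγ₂ : 8 * (C * bB.κ * c) * (A₁ * (4 * (p₁ : ℝ)) ^ p₁ * Real.sqrt γ) ≤ α * β) :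
    Ineq148 ‖B8Ineq132.plaqF (gaugeAct g (B8Lemma1NonAbelian.mulCfg (B8Eq146AExpansion.expCfg
        (B8Eq146AExpansion.iEta η H)) U₀)) μ ν x - 1‖ ‖B8Ineq132.plaqF U₀ μ ν x - 1‖
      α β ((1 / 2 : ℝ) ^ (j - i)) (εi * Linv ^ 2) := by
  have hB₃0 : 0 ≤ C * bB.κ * c := mul_nonneg (mul_nonneg hC bB.κ_nonneg) hc
  have hsmall : 128 * (C * bB.κ * c) * δ'j ≤ 1 :=
    (mul_le_mul_of_nonneg_left hδ'γ (by positivity)).trans hsmallγ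
  exact ineq148_lattice_of_ineq190_gamma h190₀ h190₁ hC hd hrow hτ hστ B hm y hD hmv₀ hmv₁ hη h₀ hH hg μ ν x hdom₁ hdom₂
    hdom₃ hdom₄ hdomD₁ hdomD₂ hL hLinv hLinv1 hc hδ'j hdist hsmall hflow hεi hA₀ hA₁ hβ₀ hδ' hεj hgeo hM hp hgj hgjγ hγe hγ₁
    hδ'γ hγ₂

end Literature.MathematicalPhysics.QuantumFieldTheory.Balaban1983to89.B15Ineq148From190
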